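import Literature.MathematicalPhysics.QuantumFieldTheory.Balaban1983to89.B8Eq191FlatLettersRDOfReal

/-!
# `Balaban1983to89.B8Eq191FlatLettersRDTau` — THE COMPLETE [4]-LETTERS BLOCK OF THE JOIN AT `U₀ = 1` ON A FINITE DIRICHLET REGION FROM THREE REAL INEQUALITY
# FAMILIES, **WITH THE LETTERS' `τ`-COMPATIBILITY** (joint J-SU: `H′`, `G′`, `R = 1 − G′QᵀCQG′` map `τ`-free data to `τ`-free configurations, for any continuous
# ℂ-linear functional `τ` — they are REAL KERNELS ⊗ id)

statement-level skeleton of published theorems with citation tags; proofs where landed; nothing here is a claim about the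
Yang–Mills mass gap

T. Bałaban, *Spaces of regular gauge field configurations on a lattice and gauge fixing conditions*, Commun. Math. Phys. **99** (1985) 75–102
`[Balaban1985RegularSpaces]` ("B8"): (1.91)–(1.92) p. 91, (1.95)–(1.98) p. 92, (1.101) p. 93, p. 96 («Q′H′ = I»), Prop. 5 p. 94, p. 76 («G = SU(N)»); T. Bałaban,
*Propagators for lattice gauge theories in a background field*, CMP **99** (1985) 389–434 `[Balaban1985BackgroundPropagators]` ("[4]"): Thms 3.1–3.2 p. 397,
(3.23)–(3.25) p. 394 («⊗ identity» at `U = 1`); T. Bałaban, *Propagators and renormalization transformations … II*, CMP **96** (1984) 223–250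
`[Balaban1984PropagatorsII]` p. 235.  STATUS: published, refereed.

CITATION HEADER (lean-in-tree rule).  Cell `pub-ymgap` (HUMAN RULING D-0062, Track A), DAG node N05 = [B8], seat `pub-ymgap-dag-n05-e` g33 (Prop-6 γ-crown authoring
lineage; this seat's g4 typed `B8Eq191FlatLettersRDOfReal`), CROSS-CELL SERVICE for cell `ym3-torus` (LEAD-H ★ym-ust-19200-w5 g6, line H-P6J of crux
stmt-QuantumFields-19200; pub-ymgap bus XCELL-1∕2, INTENT-G1): file (F3) of the `G`-valued re-run of this seat's γ chain — the one piece of NEW (bookkeeping) content: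
the trace-free JOIN of ym3-torus (`B8SectETraceFree.hFP_kLevel_of_sectE_local'_RD_traceFree`, `B8SockHFPTraceFree`, `B8SockHFP59GammaTraceFree`) asks the [4]-letters to be
`τ`-compatible (`hHτ hGτ hRτ`); for the CONSTRUCTED flat letters at `U₀ = 1` of this lineage (real kernels `T⁻¹`, `T⁻¹T⁻¹Qᵀ(QT⁻¹T⁻¹Qᵀ)⁻¹`,
`T⁻¹Qᵀ(QT⁻¹T⁻¹Qᵀ)⁻¹QT⁻¹` ⊗ id on the finite region, displayed by `B8Eq191FlatLettersExplicit.exists_flatLetters_dirichlet_explicit`) this is the commutation of a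
continuous ℂ-linear `τ` with finite sums of real scalar multiples.  WHAT IS CERTIFIED.  ★ `flatLettersRD_of_real_tau` — `B8Eq191FlatLettersRDOfReal.flatLettersRD_of_real`
VERBATIM (statement and proof) plus a parameter `(τ : 𝔸 →L[ℂ] ℂ)` and THREE more conclusion conjuncts, in the letter shapes of
`B8SockHFPTraceFree.sockHFP_body_of_join_RD_traceFree`'s `hHτ hGτ hRτ`.  Helper `apply_sum_real_smul_eq_zero`.  Kind «kernel-checked proof», theorems only: no `def`,
no `… : Prop` fact, no `instance`, no `notation`, no existing module modified.  `--supports stmt-QuantumFields-19200` (ym3-torus's crux; count-neutral for both cells).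

HONEST SCOPE.  The three REAL inequality families stay HYPOTHESES exactly as in `flatLettersRD_of_real` (discharged downstream by dag-n05-c's suppliers on print's
sub-lattice); nothing of [B8]∕[4] asserted; N05's Track-A status untouched; rung R3 is ym3-torus's and NOT Clay; pub-ymgap = one finite 𝕋⁴ programme at fixed ε;
nothing continuum ∕ ℝ⁴ ∕ OS ∕ mass-gap ∕ Clay.  No `sorry`, no `def`.
-/

noncomputable section

namespace Literature.MathematicalPhysics.QuantumFieldTheory.Balaban1983to89.B8Eq191FlatLettersRDTau

open Finset
open scoped Matrix
open B7Prop1Explicit (e)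
open B7Eq78Linearization (QprimeIter zdBlocking)
open B8Ineq132 (covDerivFwd)
open B8Eq119TwistedAxial (bgT)
open B8Eq138LandauZd (covLap QT)
open B8Eq140Level (SideTouches)
open B8Eq1117Concrete (XSpace)
open B8Prop5ContractionKLevel (Bd2)
open B8LambdaSpaceKLevel (wt)
open Literature.MathematicalPhysics.QuantumLattice (blockMap)
open B8Eq191FlatStencils (QT_flat_apply QprimeIter_flat_eq_sum_of_supp)
open B8Eq191FlatLettersDirichlet (kernel_comp tower_sum_eq)
open B8Eq191FlatLettersExplicit (exists_flatLetters_dirichlet_explicit)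
open B8Eq191FlatBoundsTransfer (hG_flat_of_real hH_flat_of_real hRbd_flat_of_real)

-- `Site` alone could resolve to the torus sites of `Setup.lean`; re-export the `ℤ^d` sites of `B7Prop1Explicit`.
export B7Prop1Explicit (Site)

variable {d : ℕ}

section Letters

variable {𝔸 : Type*} [CStarAlgebra 𝔸]

/-- A continuous ℂ-linear functional commutes with finite sums of REAL scalar multiples: if `τ(a i) = 0` for all `i ∈ s` then `τ(Σ_{i∈s} r_i • a_i) = 0`
(the «real kernel ⊗ id» letters map `τ`-free data to `τ`-free configurations). [cite: Balaban1985BackgroundPropagators, (3.23)–(3.25) p.394 («⊗ identity»); Balaban1985RegularSpaces, p.76 (bookkeeping)] -/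
theorem apply_sum_real_smul_eq_zero (τ : 𝔸 →L[ℂ] ℂ) {ι : Type*} (s : Finset ι) (r : ι → ℝ) (a : ι → 𝔸)
    (h : ∀ i ∈ s, τ (a i) = 0) : τ (∑ i ∈ s, r i • a i) = 0 := by
  rw [map_sum]
  refine Finset.sum_eq_zero fun i hi => ?_
  rw [RCLike.real_smul_eq_coe_smul (K := ℂ) (r i) (a i), map_smul, h i hi, smul_zero]

open Classical in
/-- ★ **THE COMPLETE [4]-LETTERS BLOCK OF THE JOIN AT `U₀ = 1` ON A FINITE DIRICHLET REGION, FROM THREE REAL INEQUALITY FAMILIES, WITH THE LETTERS'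
`τ`-COMPATIBILITY.**  `B8Eq191FlatLettersRDOfReal.flatLettersRD_of_real` VERBATIM (data, the three real families `realG realH realR`, the sixteen binders of
`B8SockHFPRD.sockHFP_body_of_join_RD` at `U₀ := 1`) PLUS, for a continuous ℂ-linear functional `τ : 𝔸 → ℂ`: `H′` maps `τ`-free tower families to `τ`-free
configurations, `G′` maps configurations `τ`-free on the `Ω_j` to `τ`-free configurations, and `R = 1 − G′QᵀCQG′` likewise on the `Ω_j` — because the letters are the
real kernels `T⁻¹`, `T⁻¹T⁻¹Qᵀ(QT⁻¹T⁻¹Qᵀ)⁻¹`, `T⁻¹Qᵀ(QT⁻¹T⁻¹Qᵀ)⁻¹QT⁻¹` ⊗ id (supported on `Ω₀`), and `τ` commutes with finite sums of real scalar multiples.  These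
are the binders `hHτ hGτ hRτ` of ym3-torus's trace-free JOIN (`B8SockHFPTraceFree.sockHFP_body_of_join_RD_traceFree`, print p. 76 «G = SU(N)»: `λ` trace-free ⇒
`e^{iλ} ∈ SU(N)`).
[cite: Balaban1985RegularSpaces, (1.91)–(1.92) p.91, (1.95)–(1.98) p.92, (1.101) p.93, p.96, Prop. 5 p.94, p.76; Balaban1985BackgroundPropagators, Thms 3.1–3.2 p.397, (3.23)–(3.25) p.394; Balaban1984PropagatorsII, p.235] -/
theorem flatLettersRD_of_real_tau (τ : 𝔸 →L[ℂ] ℂ) (hd : 0 < d) {η : ℝ} (hη : 0 < η) {L : ℕ} (hL : 1 ≤ L) (n : ℕ) (Ω : ℕ → Set (Site d))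
    (hΩ0 : ∀ j, j ≤ n → Ω j ⊆ Ω 0) (Λs : ℕ → Set (Site d)) (a : ℕ → ℝ) (ha : ∀ j, 0 ≤ a j)
    (S : Finset (Site d)) (hS : ∀ w, w ∈ S ↔ w ∈ Ω 0)
    (hmeet : ∀ j, j ≤ n → ∀ y ∈ Λs j, ∃ z ∈ Ω 0, blockMap (L ^ j) z = y)
    (hdisj : ∀ j, j ≤ n → ∀ j', j' ≤ n → ∀ y ∈ Λs j, ∀ y' ∈ Λs j', ∀ z ∈ Ω 0,
      blockMap (L ^ j) z = y → blockMap (L ^ j') z = y' → j = j' ∧ y = y')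
    (B : Finset (ℕ × Site d)) (hB : ∀ p, p ∈ B ↔ p.1 ≤ n ∧ p.2 ∈ Λs p.1)
    (K : Site d → Site d → ℝ)
    (hK : ∀ x z, K x z = ((η ^ 2)⁻¹ * ∑ μ : Fin d, ((2 : ℝ) * (if z = x then (1 : ℝ) else 0) - (if z = x + e μ then (1 : ℝ) else 0)
      - (if z = x - e μ then (1 : ℝ) else 0))) +
      (∑ j ∈ Finset.range (n + 1), (if blockMap (L ^ j) x ∈ Λs j ∧ blockMap (L ^ j) z = blockMap (L ^ j) x then
        a j * ((((L : ℝ) ^ d)⁻¹) ^ j) ^ 2 else 0)))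
    (T : Matrix ↥S ↥S ℝ) (hT : T = Matrix.of fun x z : ↥S => K x.1 z.1)
    (Q : Matrix ↥B ↥S ℝ)
    (hQ : Q = Matrix.of fun (p : ↥B) (z : ↥S) => if blockMap (L ^ p.1.1) z.1 = p.1.2 then (((L : ℝ) ^ d)⁻¹) ^ p.1.1 else 0)
    {BG B₀'H B₂' BR : ℝ}
    -- (1.101) for `T⁻¹`, real lattice functions
    (realG : ∀ (ρ : ↥S → ℝ) (r : ℝ), 0 ≤ r → (∀ j, j ≤ n → ∀ z : ↥S, z.1 ∈ Ω j → wt L η j ^ 2 * |ρ z| ≤ r) →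
      ∀ φ : Site d → ℝ, (∀ x, x ∉ Ω 0 → φ x = 0) → (∀ w : ↥S, φ w.1 = ∑ z : ↥S, T⁻¹ w z * ρ z) →
      (∀ x, |φ x| ≤ BG * r) ∧
      ∀ j, j ≤ n → ∀ p ∈ {b : Site d × Fin d | SideTouches (Ω j) b.1 b.2},
        wt L η j * |η⁻¹ * (φ (p.1 + e p.2) - φ p.1)| ≤ BG * r)
    -- (1.92) and the p. 93 `Δ`-entry for `T⁻¹(T⁻¹Qᵀ)(QT⁻¹T⁻¹Qᵀ)⁻¹`, real `X`
    (realH : ∀ (X : ↥B → ℝ) (s : ℝ), 0 ≤ s → (∀ p', |X p'| ≤ s) →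
      ∀ φ : Site d → ℝ, (∀ x, x ∉ Ω 0 → φ x = 0) →
      (∀ w : ↥S, φ w.1 = ∑ p' : ↥B, (T⁻¹ * (T⁻¹ * Qᵀ) * (Q * T⁻¹ * T⁻¹ * Qᵀ)⁻¹) w p' * X p') →
      (∀ x, |φ x| ≤ B₀'H * s) ∧
      (∀ j, j ≤ n → ∀ p ∈ {b : Site d × Fin d | SideTouches (Ω j) b.1 b.2},
        wt L η j * |η⁻¹ * (φ (p.1 + e p.2) - φ p.1)| ≤ B₀'H * s) ∧
      (∀ j, j ≤ n → ∀ x ∈ Ω j,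
        wt L η j ^ 2 * |∑ μ : Fin d, (η ^ 2)⁻¹ * (2 * φ x - φ (x + e μ) - φ (x - e μ))| ≤ B₂' * s))
    -- (1.98) for `1 − T⁻¹Qᵀ(QT⁻¹T⁻¹Qᵀ)⁻¹QT⁻¹`, real lattice functions
    (realR : ∀ (ρ : ↥S → ℝ) (r : ℝ), 0 ≤ r → (∀ j, j ≤ n → ∀ z : ↥S, z.1 ∈ Ω j → wt L η j ^ 2 * |ρ z| ≤ r) →
      ∀ j, j ≤ n → ∀ w : ↥S, w.1 ∈ Ω j →
        wt L η j ^ 2 * |ρ w - ∑ z : ↥S, (T⁻¹ * (Qᵀ * ((Q * T⁻¹ * T⁻¹ * Qᵀ)⁻¹ * (Q * T⁻¹)))) w z * ρ z| ≤ BR * r) :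
    ∃ (g Δ : (Site d → 𝔸) →ₗ[ℂ] (Site d → 𝔸)) (q : (Site d → 𝔸) →ₗ[ℂ] (ℕ → Site d → 𝔸))
      (qs : (ℕ → Site d → 𝔸) →ₗ[ℂ] (Site d → 𝔸)) (Aw c : (ℕ → Site d → 𝔸) →ₗ[ℂ] (ℕ → Site d → 𝔸))
      (H' : XSpace d n 𝔸 →ₗ[ℂ] (Site d → 𝔸)),
      (∀ x, ∀ y ∈ Ω 0, (Δ (g x) + qs (Aw (q (g x)))) y = x y) ∧ (∀ f, q (g (g (qs (c (q f))))) = q f) ∧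
      (∀ (f : Site d → 𝔸), ∀ x ∈ Ω 0, Δ f x = covLap η (1 : Site d → Fin d → 𝔸ˣ) ((Ω 0).indicator f) x) ∧
      (∀ (μ : ℕ → Site d → 𝔸), ∀ x ∈ Ω 0, qs μ x = QT L n Λs (1 : Site d → Fin d → 𝔸ˣ) μ x) ∧
      (∀ (f : Site d → 𝔸) (j : ℕ), j ≤ n → ∀ y ∈ Λs j, q f j y = QprimeIter (zdBlocking d L) (bgT L (1 : Site d → Fin d → 𝔸ˣ)) j f y) ∧
      (∀ (X : XSpace d n 𝔸) (x : Site d), ‖H' X x‖ ≤ B₀'H * ‖X‖) ∧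
      (∀ j, j ≤ n → ∀ (X : XSpace d n 𝔸), ∀ p ∈ {b : Site d × Fin d | SideTouches (Ω j) b.1 b.2},
        wt L η j * ‖covDerivFwd η (1 : Site d → Fin d → 𝔸ˣ) p.2 (H' X) p.1‖ ≤ B₀'H * ‖X‖) ∧
      (∀ X : XSpace d n 𝔸, Bd2 L η n Ω (covLap η (1 : Site d → Fin d → 𝔸ˣ) (H' X)) (B₂' * ‖X‖)) ∧
      (∀ (X : XSpace d n 𝔸) (x : Site d), x ∉ Ω 0 → H' X x = 0) ∧
      (∀ X Y : XSpace d n 𝔸, (∀ p, Y p = -star (X p)) → ∀ x, H' Y x = -star (H' X x)) ∧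
      (∀ (Y : XSpace d n 𝔸) (j : ℕ) (hj : j ≤ n) (y : Site d), y ∈ Λs j →
        QprimeIter (zdBlocking d L) (bgT L (1 : Site d → Fin d → 𝔸ˣ)) j (H' Y) y = Y (⟨j, Nat.lt_succ_of_le hj⟩, y)) ∧
      (∀ (f : Site d → 𝔸) (r : ℝ), 0 ≤ r → Bd2 L η n Ω f r →
        (∀ x, ‖g f x‖ ≤ BG * r) ∧ ∀ j, j ≤ n → ∀ p ∈ {b : Site d × Fin d | SideTouches (Ω j) b.1 b.2},
          wt L η j * ‖covDerivFwd η (1 : Site d → Fin d → 𝔸ˣ) p.2 (g f) p.1‖ ≤ BG * r) ∧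
      (∀ (f : Site d → 𝔸) (x : Site d), x ∉ Ω 0 → g f x = 0) ∧
      (∀ f : Site d → 𝔸, (∀ j, j ≤ n → ∀ x ∈ Ω j, IsSelfAdjoint (f x)) → ∀ x, IsSelfAdjoint (g f x)) ∧
      (∀ (f : Site d → 𝔸) (r : ℝ), 0 ≤ r → Bd2 L η n Ω f r → Bd2 L η n Ω (f - g (qs (c (q (g f))))) (BR * r)) ∧
      (∀ f : Site d → 𝔸, (∀ j, j ≤ n → ∀ x ∈ Ω j, IsSelfAdjoint (f x)) →
        ∀ j, j ≤ n → ∀ x ∈ Ω j, IsSelfAdjoint ((f - g (qs (c (q (g f))))) x)) ∧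
      -- the letters' `τ`-compatibility (joint J-SU): `H′`, `G′`, `R = 1 − G′QᵀCQG′` map `τ`-free data to `τ`-free configurations
      (∀ X : XSpace d n 𝔸, (∀ p, τ (X p) = 0) → ∀ x, τ (H' X x) = 0) ∧
      (∀ f : Site d → 𝔸, (∀ j, j ≤ n → ∀ x ∈ Ω j, τ (f x) = 0) → ∀ x, τ (g f x) = 0) ∧
      (∀ f : Site d → 𝔸, (∀ j, j ≤ n → ∀ x ∈ Ω j, τ (f x) = 0) →
        ∀ j, j ≤ n → ∀ x ∈ Ω j, τ ((f - g (qs (c (q (g f))))) x) = 0) := by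
  -- the letters with the eleven laws and the four displayed kernels (g3's file 6)
  obtain ⟨g, Δ, q, qs, Aw, c, H', g_rightΩ, c_range, hΔ, hqs, hq, -, hHsupp, hHequiv, hQH, hGsupp, hGreal₀, hRreal₀, hgker, hcker,
    -, hHker⟩ := exists_flatLetters_dirichlet_explicit (𝔸 := 𝔸) hd hη.ne' hL n Λs a ha (Ω 0) S hS hmeet hdisj B hB K hK T hT Q hQ
  -- §1 the composite kernel of `G′QᵀCQG′`: `T⁻¹·Qᵀ·M⁻¹·Q·T⁻¹`, `M = QT⁻¹T⁻¹Qᵀ`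
  have hg_supp : ∀ (f : Site d → 𝔸) (w : Site d), w ∉ S → g f w = 0 := fun f w hw => hGsupp f w (fun h => hw ((hS w).mpr h))
  have hq_mem : ∀ (u : Site d → 𝔸), (∀ w, w ∉ S → u w = 0) → ∀ p : ↥B, q u p.1.1 p.1.2 = ∑ z : ↥S, (Q p z) • u z.1 := by
    intro u hu p
    have hp := (hB p.1).mp p.2
    rw [hq u p.1.1 hp.1 p.1.2 hp.2, QprimeIter_flat_eq_sum_of_supp hL S u hu p.1.1 p.1.2, ← Finset.sum_coe_sort S]
    exact Finset.sum_congr rfl fun z _ => by rw [hQ, Matrix.of_apply]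
  have hqg : ∀ (f : Site d → 𝔸) (p : ↥B), q (g f) p.1.1 p.1.2 = ∑ w : ↥S, ((Q * T⁻¹) p w) • f w.1 := by
    intro f p
    rw [hq_mem _ (hg_supp f) p, Finset.sum_congr rfl fun z _ => by rw [hgker f z]]
    exact kernel_comp Q T⁻¹ (fun w : ↥S => f w.1) p
  have hcqg : ∀ (f : Site d → 𝔸) (p : ↥B),
      c (q (g f)) p.1.1 p.1.2 = ∑ w : ↥S, (((Q * T⁻¹ * T⁻¹ * Qᵀ)⁻¹ * (Q * T⁻¹)) p w) • f w.1 := by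
    intro f p
    rw [hcker, Finset.sum_congr rfl fun p' _ => by rw [hqg f p']]
    exact kernel_comp (Q * T⁻¹ * T⁻¹ * Qᵀ)⁻¹ (Q * T⁻¹) (fun w : ↥S => f w.1) p
  have hqs_ker : ∀ (φ : ℕ → Site d → 𝔸) (z : ↥S), qs φ z.1 = ∑ p : ↥B, (Qᵀ z p) • φ p.1.1 p.1.2 := by
    intro φ z
    rw [hqs φ z.1 ((hS z.1).mp z.2), QT_flat_apply, tower_sum_eq L n Λs B hB φ z.1, ← Finset.sum_coe_sort B]
    exact Finset.sum_congr rfl fun p _ => by rw [Matrix.transpose_apply, hQ, Matrix.of_apply]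
  have hqscqg : ∀ (f : Site d → 𝔸) (z : ↥S),
      qs (c (q (g f))) z.1 = ∑ w : ↥S, ((Qᵀ * ((Q * T⁻¹ * T⁻¹ * Qᵀ)⁻¹ * (Q * T⁻¹))) z w) • f w.1 := by
    intro f z
    rw [hqs_ker, Finset.sum_congr rfl fun p _ => by rw [hcqg f p]]
    exact kernel_comp Qᵀ ((Q * T⁻¹ * T⁻¹ * Qᵀ)⁻¹ * (Q * T⁻¹)) (fun w : ↥S => f w.1) z
  have hR : ∀ (f : Site d → 𝔸) (w : ↥S),
      (fun f => g (qs (c (q (g f))))) f w.1 = ∑ z : ↥S, ((T⁻¹ * (Qᵀ * ((Q * T⁻¹ * T⁻¹ * Qᵀ)⁻¹ * (Q * T⁻¹)))) w z) • f z.1 := by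
    intro f w
    show g (qs (c (q (g f)))) w.1 = _
    rw [hgker _ w, Finset.sum_congr rfl fun z _ => by rw [hqscqg f z]]
    exact kernel_comp T⁻¹ (Qᵀ * ((Q * T⁻¹ * T⁻¹ * Qᵀ)⁻¹ * (Q * T⁻¹))) (fun z : ↥S => f z.1) w
  -- §2 the five bounds by the real-kernel ⊗ id transfer
  have hG := hG_flat_of_real L hη n Ω S hS g T⁻¹ hgker hGsupp realG
  obtain ⟨hH0, hH1, hH2⟩ := hH_flat_of_real L hη n Ω Λs S hS B hB H' (T⁻¹ * (T⁻¹ * Qᵀ) * (Q * T⁻¹ * T⁻¹ * Qᵀ)⁻¹) hHker hHsupp realH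
  have hRbd := hRbd_flat_of_real (𝔸 := 𝔸) L n Ω hΩ0 S hS (fun f => g (qs (c (q (g f)))))
    (T⁻¹ * (Qᵀ * ((Q * T⁻¹ * T⁻¹ * Qᵀ)⁻¹ * (Q * T⁻¹)))) hR realR
  refine ⟨g, Δ, q, qs, Aw, c, H', g_rightΩ, c_range, hΔ, hqs, hq, hH0, hH1, hH2, hHsupp, hHequiv, hQH, hG, hGsupp, ?_, ?_, ?_, ?_, ?_, ?_⟩
  · -- reality of `G′`
    intro f hf
    exact hGreal₀ f (fun x hx => hf 0 (Nat.zero_le _) x hx)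
  · -- (1.98)
    intro f r hr hf
    exact hRbd f r hr hf
  · -- reality of `R = 1 − G′QᵀCQG′`
    intro f hf j hj x hx
    rw [Pi.sub_apply]
    exact (hf j hj x hx).sub (hRreal₀ f (fun y hy => hf 0 (Nat.zero_le _) y hy) x)

  · -- `τ`-compatibility of `H′ = T⁻¹T⁻¹Qᵀ(QT⁻¹T⁻¹Qᵀ)⁻¹ ⊗ id`
    intro X hX x
    by_cases hx : x ∈ Ω 0
    · rw [show x = (⟨x, (hS x).mpr hx⟩ : ↥S).1 from rfl, hHker]
      exact apply_sum_real_smul_eq_zero τ _ _ _ fun p _ => hX _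
    · rw [hHsupp X x hx, map_zero]
  · -- `τ`-compatibility of `G′ = T⁻¹ ⊗ id`
    intro f hf x
    by_cases hx : x ∈ Ω 0
    · rw [show x = (⟨x, (hS x).mpr hx⟩ : ↥S).1 from rfl, hgker]
      exact apply_sum_real_smul_eq_zero τ _ _ _ fun z _ => hf 0 (Nat.zero_le _) z.1 ((hS z.1).mp z.2)
    · rw [hGsupp f x hx, map_zero]
  · -- `τ`-compatibility of `R = 1 − G′QᵀCQG′ = (1 − T⁻¹Qᵀ(QT⁻²Qᵀ)⁻¹QT⁻¹) ⊗ id`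
    intro f hf j hj x hx
    have hx0 : x ∈ Ω 0 := hΩ0 j hj hx
    rw [Pi.sub_apply, map_sub, hf j hj x hx, zero_sub, neg_eq_zero, show x = (⟨x, (hS x).mpr hx0⟩ : ↥S).1 from rfl]
    have hRx := hR f ⟨x, (hS x).mpr hx0⟩
    simp only at hRx
    rw [hRx]
    exact apply_sum_real_smul_eq_zero τ _ _ _ fun z _ => hf 0 (Nat.zero_le _) z.1 ((hS z.1).mp z.2)

end Letters

#print axioms flatLettersRD_of_real_tau

end Literature.MathematicalPhysics.QuantumFieldTheory.Balaban1983to89.B8Eq191FlatLettersRDTau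

end
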